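import Literature.Probability.LatticeModels.BlockExplorationNested
import Literature.Probability.LatticeModels.RandomClusterRimWiringOutside
import HarnessLib

/-!
# One level of Kesten's chain for the random-cluster measure (proved)

Topic `Literature/Probability/LatticeModels`; companion of `BlockExplorationNested.lean`
(combinatorics of a nested pair of exploration data, D. Basu, A. Sapozhnikov, ECP 22 (2017), §2)
and of `RandomClusterRimWiringOutside.lean` (conditional independence of the configurations on
and off the edges touching an explored set whose rim is wired from inside).

Fix a finite graph `G`, the free random-cluster measure `φ = φ^∅_{G,p,q}` (`0 ≤ p ≤ 1`, `q > 0`),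
an outer explored set `U` with outer rim `R` and an anchor `x`. For an inner datum `(U', R')`
(inner explored set `U' ∋ x` of the block `Blk'` from `In'`, inner rim `R'`, the rim WIRED
through `U'`) write `F = F(U', R')` for the saturated wired datum event,
`InU = {x is joined inside U to a vertex carrying an open edge to R}` (the inside piece of the
outer level), `InU'` for the inside piece of the inner level and `Mid` for the middle piece
(some inner-rim vertex is joined inside `U ∖ U'` to a vertex carrying an open edge to `R`).

* `insidePiece_factorisation` (CH-prob): for a context event `Fo` determined off the edges `T`
  touching `U'`, `φ(F ∩ Fo ∩ InU) · φ(F) = φ(F ∩ InU') · φ(F ∩ Fo ∩ Mid)` — the set identity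
  `F ∩ InU = F ∩ InU' ∩ Mid` of `BlockExplorationNested.lean` and the conditional independence,
  given `F`, of `InU'` (read on `T`) and `Fo ∩ Mid` (read off `T`).
* `insidePiece_eq_sum_add_notWired` (CH-sum): summing over all inner data,
  `φ(Fo ∩ InU) = Σ_{d'} φ(F(d') ∩ Fo ∩ Mid(d')) · u_x(d') + φ(Fo ∩ InU ∩ {rim not wired})` with the
  CONDITIONAL inside probability `u_x(d') = φ(F(d') ∩ InU'(d')) / φ(F(d'))` — Kesten's one-level
  chain identity (PTRF 73 (1986), proof of Thm. 3, eqs. (16)–(19)) in the planarity-free form of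
  Basu–Sapozhnikov (§2, eqs. (2.5)–(2.7)), before dividing by the probability of the outer datum.

Everything is proved; no definitions.

## References
* [BasuSapozhnikov2017ECP] D. Basu, A. Sapozhnikov, *Kesten's incipient infinite cluster and
  quasi-multiplicativity of crossing probabilities*, Electron. Commun. Probab. 22 (2017) no. 26,
  §2, eqs. (2.5)–(2.7).
* [Kesten1986] H. Kesten, The incipient infinite cluster in two-dimensional percolation,
  *Probab. Theory Related Fields* 73 (1986) 369–394, proof of Thm. 3, eqs. (16)–(19).
* [Grimmett2006] G. Grimmett, *The Random-Cluster Model*, Springer (2006), Lemma (4.13).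
-/

open MeasureTheory Finset SimpleGraph
open Literature.Probability.Percolation (BondConfig openConnIn explSet explRim explEvent explRimWired)

namespace Literature.Probability.LatticeModels

/-- **(CH-prob) Factorisation of the outer inside piece at a nested wired inner datum** (free
random-cluster measure). With `F` the saturated event `{ω | ω ∩ E(G) ∈ {𝒞 = U', 𝒟 = R'} ∩ {rim
wired through U'}}`, `T` the `G`-edges touching `U'`, `Fo` any event determined off `T`, `InU`,
`InU'`, `Mid` the outer inside piece, the inner inside piece and the middle piece (all read on
`ω ∩ E(G)`): `φ(F ∩ Fo ∩ InU) · φ(F) = φ(F ∩ InU') · φ(F ∩ Fo ∩ Mid)`. Proof: as sets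
`F ∩ InU = F ∩ InU' ∩ Mid` (`insidePiece_iff_of_nested_explEvent`); `InU'` is determined by
`ω ∩ T`, `Fo ∩ Mid` by `ω ∩ (E(G) ∖ T)`, and given `F` these are conditionally independent
(`rcMeasure_real_condIndep_of_rim_wired_outside`, whose hypotheses on `F` are
`explEvent_wired_rimHyps`). [cite: BasuSapozhnikov2017ECP, §2 eqs. (2.5)–(2.7)] -/
theorem insidePiece_factorisation :
    ∀ {V : Type*} [Fintype V] [DecidableEq V] (G : SimpleGraph V) [DecidableRel G.Adj] {p q : ℝ}, p ∈ Set.Icc (0 : ℝ) 1 → 0 < q → ∀ (In' Blk' U' R' U R : Set V) (T : Finset (Sym2 V)), (∀ e, e ∈ T ↔ e ∈ G.edgeFinset ∧ ∃ v ∈ U', v ∈ e) → U' ⊆ U → R' ⊆ U → (∀ r ∈ R, r ∉ U' ∧ r ∉ R') → ∀ (x : V), x ∈ U' → ∀ (Fo : Set (Literature.Probability.Percolation.BondConfig V)), (∀ ω₁ ω₂ : Literature.Probability.Percolation.BondConfig V, ω₁ ∩ (↑(G.edgeFinset \ T)) = ω₂ ∩ (↑(G.edgeFinset \ T)) → (ω₁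 ∈ Fo ↔ ω₂ ∈ Fo)) → let Eg : Set (Sym2 V) := ↑G.edgeFinset; let F : Set (Literature.Probability.Percolation.BondConfig V) := {ω | ω ∩ Eg ∈ Literature.Probability.Percolation.explEvent In' Blk' U' R' ∩ {ω | ∀ r ∈ R', ∀ r₂ ∈ R', ∃ v ∈ U', ∃ v' ∈ U', s(v, r) ∈ ω ∧ s(v', r₂) ∈ ω ∧ ω ∈ Literature.Probability.Percolation.openConnIn U' v v'}}; let InU : Set (Literature.Probability.Percolation.BondConfig V) := {ω | ∃ w ∈ R, ∃ v ∈ U, ω ∩ Eg ∈ Literature.Probability.Percolation.openConnIn U x v ∧ s(v, w) ∈ ω ∩ Eg}; let InU' : Set (Literature.Probability.Percolation.BondConfig V) := {ω | ∃ w' ∈ R', ∃ v' ∈ U', ω ∩ Eg ∈ Literature.Probability.Percolation.openConnIn U' x v' ∧ s(v', w') ∈ ω ∩ Eg}; let Mid : Set (Literature.Probability.Percolation.BondConfig V) := {ω | ∃ w'' ∈ R', ∃ v ∈ U, ∃ w ∈ R, ω ∩ Eg ∈ Literature.Probability.Percolation.openConnIn (U \ U') w'' v ∧ s(v, w) ∈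 ω ∩ Eg}; (Literature.Probability.LatticeModels.rcMeasure G p q ∅).real (F ∩ Fo ∩ InU) * (Literature.Probability.LatticeModels.rcMeasure G p q ∅).real F = (Literature.Probability.LatticeModels.rcMeasure G p q ∅).real (F ∩ InU') * (Literature.Probability.LatticeModels.rcMeasure G p q ∅).real (F ∩ Fo ∩ Mid) := by
  intro V _ _ G _ p q hp hq In' Blk' U' R' U R T hT hU'U hR'U hR x hx Fo hFo Eg F InU InU' Mid
  /- (i) the combinatorial identity `F ∩ InU = F ∩ InU' ∩ Mid`, read on `ω ∩ E(G)` -/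
  have hset : F ∩ InU = F ∩ InU' ∩ Mid := by
    ext ω
    constructor
    · rintro ⟨hF, hIn⟩
      have key := insidePiece_iff_of_nested_explEvent hF.1 hF.2 hU'U hR'U hR hx
      exact ⟨⟨hF, (key.1 hIn).1⟩, (key.1 hIn).2⟩
    · rintro ⟨⟨hF, h1⟩, h2⟩
      exact ⟨hF, (insidePiece_iff_of_nested_explEvent hF.1 hF.2 hU'U hR'U hR hx).2 ⟨h1, h2⟩⟩
  /- an open `G`-edge issuing from `U'` is read on `T` -/
  have hagA : ∀ {ω₁ ω₂ : BondConfig V}, ω₁ ∩ ↑T = ω₂ ∩ ↑T →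
      ∀ a ∈ U', ∀ b : V, s(a, b) ∈ ω₁ ∩ Eg → s(a, b) ∈ ω₂ ∩ Eg := by
    rintro ω₁ ω₂ h a ha b ⟨hab, habE⟩
    have habT : s(a, b) ∈ ω₁ ∩ (↑T : Set (Sym2 V)) :=
      ⟨hab, Finset.mem_coe.2 ((hT _).2 ⟨habE, a, ha, Sym2.mem_mk_left a b⟩)⟩
    rw [h] at habT
    exact ⟨habT.1, habE⟩
  /- (ii) `InU'` is determined by `ω ∩ T` -/
  have hA : ∀ ω₁ ω₂ : BondConfig V, ω₁ ∩ ↑T = ω₂ ∩ ↑T → (ω₁ ∈ InU' ↔ ω₂ ∈ InU') := by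
    have aux : ∀ ω₁ ω₂ : BondConfig V, ω₁ ∩ ↑T = ω₂ ∩ ↑T → ω₁ ∈ InU' → ω₂ ∈ InU' := by
      rintro ω₁ ω₂ h ⟨w', hw', v', hv', h1, h2⟩
      exact ⟨w', hw', v', hv',
        Percolation.BlockExploration.openConnIn_of_agree h1 fun a ha b _ hab => hagA h a ha b hab,
        hagA h v' hv' w' h2⟩
    exact fun ω₁ ω₂ h => ⟨aux ω₁ ω₂ h, aux ω₂ ω₁ h.symm⟩
  /- an open `G`-edge with no endpoint in `U'` is read off `T` -/
  have hagC : ∀ {ω₁ ω₂ : BondConfig V},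
      ω₁ ∩ (↑(G.edgeFinset \ T)) = ω₂ ∩ (↑(G.edgeFinset \ T)) →
      ∀ a b : V, a ∉ U' → b ∉ U' → s(a, b) ∈ ω₁ ∩ Eg → s(a, b) ∈ ω₂ ∩ Eg := by
    rintro ω₁ ω₂ h a b ha hb ⟨hab, habE⟩
    have habT : s(a, b) ∉ T := fun h' => by
      obtain ⟨-, v, hv, hve⟩ := (hT _).1 h'
      rcases Sym2.mem_iff.1 hve with rfl | rfl
      · exact ha hv
      · exact hb hv
    have hmem : s(a, b) ∈ ω₁ ∩ (↑(G.edgeFinset \ T) : Set (Sym2 V)) :=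
      ⟨hab, Finset.mem_coe.2 (Finset.mem_sdiff.2 ⟨habE, habT⟩)⟩
    rw [h] at hmem
    exact ⟨hmem.1, habE⟩
  /- (ii') `Fo ∩ Mid` is determined by `ω ∩ (E(G) ∖ T)` -/
  have hC : ∀ ω₁ ω₂ : BondConfig V,
      ω₁ ∩ (↑(G.edgeFinset \ T)) = ω₂ ∩ (↑(G.edgeFinset \ T)) → (ω₁ ∈ Fo ∩ Mid ↔ ω₂ ∈ Fo ∩ Mid) := by
    have aux : ∀ ω₁ ω₂ : BondConfig V,
        ω₁ ∩ (↑(G.edgeFinset \ T)) = ω₂ ∩ (↑(G.edgeFinset \ T)) → ω₁ ∈ Mid → ω₂ ∈ Mid := by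
      rintro ω₁ ω₂ h ⟨w'', hw'', v, hv, w, hw, h1, h2⟩
      obtain ⟨_, hvU, _⟩ := id h1
      exact ⟨w'', hw'', v, hv, w, hw,
        Percolation.BlockExploration.openConnIn_of_agree h1 fun a ha b hb hab =>
          hagC h a b ha.2 hb.2 hab,
        hagC h v w hvU.2 (hR w hw).1 h2⟩
    intro ω₁ ω₂ h
    exact ⟨fun h' => ⟨(hFo ω₁ ω₂ h).1 h'.1, aux ω₁ ω₂ h h'.2⟩,
      fun h' => ⟨(hFo ω₁ ω₂ h).2 h'.1, aux ω₂ ω₁ h.symm h'.2⟩⟩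
  by_cases hRS : ∀ r ∈ R', r ∉ U'
  · /- (iii) conditional independence given `F` -/
    obtain ⟨hFdet, hFrim, hFwire⟩ := explEvent_wired_rimHyps G In' Blk' U' R' T hT
    have key := rcMeasure_real_condIndep_of_rim_wired_outside G hp hq ∅ U' R' T hT hRS
      (fun b hb => absurd hb (Set.notMem_empty b)) F hFdet hFrim hFwire InU' (Fo ∩ Mid) hA hC
    have e1 : F ∩ Fo ∩ InU = F ∩ InU' ∩ (Fo ∩ Mid) := by
      rw [Set.inter_right_comm, hset, Set.inter_assoc, Set.inter_comm Mid Fo]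
    have e2 : F ∩ Fo ∩ Mid = F ∩ (Fo ∩ Mid) := Set.inter_assoc _ _ _
    rw [e1, e2]
    exact key
  · /- degenerate case: `R'` meets `U'`, so the datum event is empty -/
    have hF0 : F = ∅ := by
      refine Set.eq_empty_iff_forall_notMem.2 fun ω hω => hRS fun r hr hrU' => ?_
      obtain ⟨⟨h1, h2⟩, -⟩ := hω
      rw [← h1] at hrU'
      rw [← h2] at hr
      exact (Percolation.mem_explRim_iff.1 hr).1 hrU'
    rw [hF0]
    simp only [Set.empty_inter, measureReal_empty, mul_zero]

/-- **(CH-sum) One level of Kesten's chain.** With `U ⊇ In' ∪ Blk'` containing every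
`G`-neighbour of `In' ∪ Blk'`, `R ∩ U = ∅`, `x ∈ In'`, and `Fo` determined by the `G`-edges with
no endpoint in `In' ∪ Blk'`: partitioning `Fo ∩ InU` according to the actual inner datum
`d' = (𝒞, 𝒟)` of `ω ∩ E(G)` (explored set of `Blk'` from `In'` and its rim) and to whether the rim
is wired through the explored set,
`φ(Fo ∩ InU) = Σ_{d'} φ(F(d') ∩ Fo ∩ Mid(d')) · (φ(F(d') ∩ InU'(d')) / φ(F(d'))) + φ(Fo ∩ InU ∩
{rim not wired})`: on `F(d')` apply `insidePiece_factorisation` (its side conditions hold as soon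
as `F(d')` is nonempty; if `φ(F(d')) = 0` both sides of the summand vanish).
[cite: Kesten1986, proof of Thm. 3, eqs. (16)–(19)] -/
theorem insidePiece_eq_sum_add_notWired :
    ∀ {V : Type*} [Fintype V] [DecidableEq V] (G : SimpleGraph V) [DecidableRel G.Adj] {p q : ℝ}, p ∈ Set.Icc (0 : ℝ) 1 → 0 < q → ∀ (In' Blk' U R : Set V), In' ⊆ U → Blk' ⊆ U → (∀ v ∈ In' ∪ Blk', ∀ w : V, G.Adj v w → w ∈ U) → (∀ r ∈ R, r ∉ U) → ∀ (x : V), x ∈ In' → ∀ (Fo : Set (Literature.Probability.Percolation.BondConfig V)), (∀ ω₁ ω₂ : Literature.Probability.Percolation.BondConfig V, (∀ e ∈ G.edgeFinset, (∀ v ∈ e, v ∉ In' ∧ v ∉ Blk') → (e ∈ ω₁ ↔ e ∈ ω₂)) → (ω₁ ∈ Fo ↔ ω₂ ∈ Fo)) → let Eg : Set (Sym2 V) := ↑G.edgeFinset; let P := Literature.Probability.LatticeModels.rcMeasure G p q ∅; let F : Set V → Set V → Set (Literature.Probability.Percolation.BondConfig V) := fun U' R' => {ω | ω ∩ Eg ∈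 Literature.Probability.Percolation.explEvent In' Blk' U' R' ∩ {ω | ∀ r ∈ R', ∀ r₂ ∈ R', ∃ v ∈ U', ∃ v' ∈ U', s(v, r) ∈ ω ∧ s(v', r₂) ∈ ω ∧ ω ∈ Literature.Probability.Percolation.openConnIn U' v v'}}; let InU : Set (Literature.Probability.Percolation.BondConfig V) := {ω | ∃ w ∈ R, ∃ v ∈ U, ω ∩ Eg ∈ Literature.Probability.Percolation.openConnIn U x v ∧ s(v, w) ∈ ω ∩ Eg}; let InU' : Set V → Set V → Set (Literature.Probability.Percolation.BondConfig V) := fun U' R' => {ω | ∃ w' ∈ R', ∃ v' ∈ U', ω ∩ Eg ∈ Literature.Probability.Percolation.openConnIn U' x v' ∧ s(v', w') ∈ ω ∩ Eg}; let Mid : Set V → Set V → Set (Literature.Probability.Percolation.BondConfig V) := fun U' R' => {ω | ∃ w'' ∈ R', ∃ v ∈ U, ∃ w ∈ R, ω ∩ Eg ∈ Literature.Probability.Percolation.openConnIn (U \ U') w'' v ∧ s(v, w) ∈ ω ∩ Eg}; let NW : Set (Literature.Probability.Percolation.BondConfig V) := {ω | ¬ Literature.Probability.Percolation.explRimWired In'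 Blk' (ω ∩ Eg)}; P.real (Fo ∩ InU) = (∑ d ∈ (Finset.univ : Finset (Finset V × Finset V)), P.real (F ↑d.1 ↑d.2 ∩ Fo ∩ Mid ↑d.1 ↑d.2) * (P.real (F ↑d.1 ↑d.2 ∩ InU' ↑d.1 ↑d.2) / P.real (F ↑d.1 ↑d.2))) + P.real (Fo ∩ InU ∩ NW) := by
  intro V _ _ G _ p q hp hq In' Blk' U R hIn'U hBlk'U hnb hRU x hx Fo hFo Eg P F InU InU' Mid NW
  classical
  haveI : IsProbabilityMeasure P := isProbabilityMeasure_rcMeasure G hp hq ∅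
  /- Step A: on each datum event the summand is the probability of `F d ∩ Fo ∩ InU` -/
  have stepA : ∀ d : Finset V × Finset V,
      P.real (F ↑d.1 ↑d.2 ∩ Fo ∩ InU) =
        P.real (F ↑d.1 ↑d.2 ∩ Fo ∩ Mid ↑d.1 ↑d.2) *
          (P.real (F ↑d.1 ↑d.2 ∩ InU' ↑d.1 ↑d.2) / P.real (F ↑d.1 ↑d.2)) := by
    intro d
    by_cases h0 : P.real (F ↑d.1 ↑d.2) = 0
    · rw [h0, div_zero, mul_zero]
      exact measureReal_mono_null (fun ω hω => hω.1.1) h0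
    · -- the datum event is nonempty, whence the side conditions of (CH-prob)
      obtain ⟨ω₀, hω₀⟩ : (F ↑d.1 ↑d.2).Nonempty :=
        Set.nonempty_iff_ne_empty.2 fun h => h0 (by rw [h, measureReal_empty])
      obtain ⟨⟨hS, hRim⟩, -⟩ := hω₀
      have hd1 : (↑d.1 : Set V) ⊆ In' ∪ Blk' := by
        rw [← hS]
        exact Percolation.explSet_subset In' Blk' _
      have hd1U : (↑d.1 : Set V) ⊆ U := hd1.trans (Set.union_subset hIn'U hBlk'U)
      have hd2U : (↑d.2 : Set V) ⊆ U := by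
        intro w hw
        rw [← hRim] at hw
        obtain ⟨-, v, hv, hvw⟩ := Percolation.mem_explRim_iff.1 hw
        have hvwE : s(v, w) ∈ G.edgeFinset := hvw.2
        exact hnb v (Percolation.explSet_subset In' Blk' _ hv) w
          (SimpleGraph.mem_edgeFinset.1 hvwE)
      have hRd : ∀ r ∈ R, r ∉ (↑d.1 : Set V) ∧ r ∉ (↑d.2 : Set V) :=
        fun r hr => ⟨fun h => hRU r hr (hd1U h), fun h => hRU r hr (hd2U h)⟩
      have hxd : x ∈ (↑d.1 : Set V) := by
        rw [← hS]
        exact Percolation.subset_explSet In' Blk' _ hx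
      -- the `G`-edges touching the inner explored set
      obtain ⟨T, hT⟩ : ∃ T : Finset (Sym2 V), ∀ e, e ∈ T ↔ e ∈ G.edgeFinset ∧ ∃ v ∈ (↑d.1 : Set V), v ∈ e :=
        ⟨G.edgeFinset.filter fun e => ∃ v ∈ (↑d.1 : Set V), v ∈ e, fun e => Finset.mem_filter⟩
      have hFoT : ∀ ω₁ ω₂ : BondConfig V,
          ω₁ ∩ (↑(G.edgeFinset \ T)) = ω₂ ∩ (↑(G.edgeFinset \ T)) → (ω₁ ∈ Fo ↔ ω₂ ∈ Fo) := by
        intro ω₁ ω₂ h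
        refine hFo ω₁ ω₂ fun e he hout => ?_
        have heT : e ∉ T := fun heT => by
          obtain ⟨-, v, hv, hve⟩ := (hT e).1 heT
          rcases hd1 hv with hvIn | hvBlk
          · exact (hout v hve).1 hvIn
          · exact (hout v hve).2 hvBlk
        have he' : e ∈ (↑(G.edgeFinset \ T) : Set (Sym2 V)) :=
          Finset.mem_coe.2 (Finset.mem_sdiff.2 ⟨he, heT⟩)
        exact ⟨fun h1 => ((Set.ext_iff.1 h e).1 ⟨h1, he'⟩).1,
          fun h2 => ((Set.ext_iff.1 h e).2 ⟨h2, he'⟩).1⟩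
      have key : P.real (F ↑d.1 ↑d.2 ∩ Fo ∩ InU) * P.real (F ↑d.1 ↑d.2) =
          P.real (F ↑d.1 ↑d.2 ∩ InU' ↑d.1 ↑d.2) * P.real (F ↑d.1 ↑d.2 ∩ Fo ∩ Mid ↑d.1 ↑d.2) :=
        insidePiece_factorisation G hp hq In' Blk' (↑d.1) (↑d.2) U R T hT hd1U hd2U hRd x hxd Fo
          hFoT
      rw [mul_div_assoc', eq_div_iff h0, key, mul_comm]
  /- Step B: partition of `Fo ∩ InU` by the actual inner datum of `ω ∩ E(G)` -/
  have hmeas : ∀ s : Set (BondConfig V), MeasurableSet s := fun s =>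
    (Set.to_countable s).measurableSet
  have hFiff : ∀ (d : Finset V × Finset V) (ω : BondConfig V), ω ∈ F ↑d.1 ↑d.2 ↔
      (explSet In' Blk' (ω ∩ Eg) = ↑d.1 ∧ explRim In' Blk' (ω ∩ Eg) = ↑d.2) ∧
        explRimWired In' Blk' (ω ∩ Eg) := by
    intro d ω
    constructor
    · rintro ⟨⟨h1, h2⟩, hW⟩
      refine ⟨⟨h1, h2⟩, ?_⟩
      rw [Percolation.explRimWired_iff, h1, h2]
      exact hW
    · rintro ⟨⟨h1, h2⟩, hW⟩
      rw [Percolation.explRimWired_iff, h1, h2] at hW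
      exact ⟨⟨h1, h2⟩, hW⟩
  have hUnion : Fo ∩ InU ∩ NWᶜ =
      ⋃ d ∈ (Finset.univ : Finset (Finset V × Finset V)), (F ↑d.1 ↑d.2 ∩ Fo ∩ InU) := by
    ext ω
    rw [Set.mem_iUnion₂]
    constructor
    · rintro ⟨⟨hFo', hIn⟩, hNW⟩
      refine ⟨((Set.toFinite (explSet In' Blk' (ω ∩ Eg))).toFinset,
        (Set.toFinite (explRim In' Blk' (ω ∩ Eg))).toFinset), Finset.mem_univ _, ⟨?_, hFo'⟩, hIn⟩
      rw [hFiff]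
      simp only [Set.Finite.coe_toFinset, true_and]
      exact Classical.byContradiction (Set.notMem_of_mem_compl hNW)
    · rintro ⟨d, -, ⟨hF', hFo'⟩, hIn⟩
      exact ⟨⟨hFo', hIn⟩, Set.mem_compl fun h => h ((hFiff d ω).1 hF').2⟩
  have hdisj : (↑(Finset.univ : Finset (Finset V × Finset V)) : Set (Finset V × Finset V)).PairwiseDisjoint
      fun d => F ↑d.1 ↑d.2 ∩ Fo ∩ InU := by
    intro d _ d' _ hne
    dsimp only [Function.onFun]
    rw [Set.disjoint_left]
    rintro ω ⟨⟨hF1, -⟩, -⟩ ⟨⟨hF2, -⟩, -⟩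
    obtain ⟨⟨h1, h2⟩, -⟩ := (hFiff d ω).1 hF1
    obtain ⟨⟨h1', h2'⟩, -⟩ := (hFiff d' ω).1 hF2
    exact hne (Prod.ext (Finset.coe_injective (h1.symm.trans h1'))
      (Finset.coe_injective (h2.symm.trans h2')))
  have hsum : ∑ d ∈ (Finset.univ : Finset (Finset V × Finset V)),
      P.real (F ↑d.1 ↑d.2 ∩ Fo ∩ Mid ↑d.1 ↑d.2) *
        (P.real (F ↑d.1 ↑d.2 ∩ InU' ↑d.1 ↑d.2) / P.real (F ↑d.1 ↑d.2)) =
      ∑ d ∈ (Finset.univ : Finset (Finset V × Finset V)), P.real (F ↑d.1 ↑d.2 ∩ Fo ∩ InU) :=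
    Finset.sum_congr rfl fun d _ => (stepA d).symm
  rw [hsum, ← measureReal_biUnion_finset hdisj fun d _ => hmeas _, ← hUnion,
    ← measureReal_inter_add_sdiff (s := Fo ∩ InU) (hmeas NWᶜ), Set.sdiff_compl]

end Literature.Probability.LatticeModels
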